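import Summits.BirchSwinnertonDyer.BirchSwinnertonDyer.Theorems.UniversalToricDescentStrictPlaceGrowthInputs
import HarnessLib

/-!
# The dual of the tuple target `Hom(H¹(kerD, E[p^∞])^{p^c}, ℚ/ℤ)` is a finitely generated TORSION-FREE `Λ`-module under the local
# two-sided count (crux ♭T≤ stmt-BirchSwinnertonDyer-23042, line `sigmacongruence`, stub TS1′ `stub_twinStrictSurj`, assembly (1e))

Route `UniversalToricDescent`, lead prover `bsd-wall-utd-p1` g16. THEOREMS ONLY (no definition, no named fact, no `sorry`);
`--supports stmt-BirchSwinnertonDyer-23042`. BSD is not proved by any of this.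

For the componentwise endomorphism `Ψ` of `P = (Fin m → 𝓗)`, `𝓗 = H¹(kerD κ 𝔭, E[p^∞])`, induced by `conj_{d₁}` (`κ d₁ = p^c` the exact
index), the `Λ`-module `X_P = Hom(P, ℚ/ℤ)` (`IsLocNil.module` for `Ψ − 1`):

* `moduleFinite_dual_tuple` — `X_P` is finitely generated when `{y | p y = 0, conj_{d₁} y = y}` is finite (Nakayama for dual pairs);
* `natCard_dual_tuple_quotient_eq` — `#(X_P ⧸ (p^k, ω_n) X_P) = #{y | p^k y = 0, conj_{d₁^{p^n}} y = y}^m` (p646050 + the tuple count);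
* `noZeroSMulDivisors_dual_tuple` — under the two-sided local count `p^{ρ p^n k} ≤ p^b · #{…} ≤ p^{ρ p^n k + b}`, `X_P` is
  `Λ`-torsion-free (`𝓗` is `p`-divisible at a finitely decomposed place, so `X_P[p] = 0`; then p660065
  `noZeroSMulDivisors_of_card_quotient_bounds` with `ρ m`, `b m`).

References: [GreenbergVatsal2000] §2 Prop. (2.1) (the torsion-free local term); [GreenbergLNM1716] §1 p. 60; [Washington1997] §13.2.
-/

set_option autoImplicit false
-- the Theorems namespace of this sub repeats the summit name by design (D-0017 nested layout)
set_option linter.dupNamespace false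

noncomputable section

open scoped Classical

namespace Summit.BirchSwinnertonDyer.BirchSwinnertonDyer.Theorems.UniversalToricDescentStrictPlaceGrowth

open Function Field NumberField IsDedekindDomain WeierstrassCurve
open Literature.NumberTheory.GaloisRepresentations Literature.NumberTheory.EllipticCurves
  Literature.NumberTheory.EllipticCurves.GreenbergSelmer Literature.NumberTheory.EllipticCurves.IwasawaDual
  Summit.BirchSwinnertonDyer.Rank1Residual Summit.BirchSwinnertonDyer.Rank1Residual.X11b
  Summit.BirchSwinnertonDyer.Rank1Residual.X11b.Coinv
  Summit.BirchSwinnertonDyer.BirchSwinnertonDyer.Theorems.UniversalToricDescentTorsionFreeByCount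
  Summit.BirchSwinnertonDyer.BirchSwinnertonDyer.Theorems.UniversalToricDescentDualPairIdealCount

variable {K : Type} [Field K] [NumberField K] (W : WeierstrassCurve K) [W.IsElliptic] (p : ℕ)
  [Fact p.Prime] (κ : ZpExtension K p)

omit [W.IsElliptic] in
/-- **`X_P = Hom(𝓗^m, ℚ/ℤ)` is finitely generated** when `{y ∈ 𝓗 | p y = 0, conj_{d₁} y = y}` is finite. [cite: GreenbergLNM1716, §1 p. 60] -/
theorem moduleFinite_dual_tuple {𝔭 : HeightOneSpectrum (𝓞 K)} (d₁ : decomp (K := K) 𝔭) (m : ℕ)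
    {φ : AddMonoid.End (subgroupH1 (kerD κ 𝔭) (W.geomPrimaryTorsion p))}
    (hφ : ∀ y, φ y = conjH1 (kerD κ 𝔭) (W.geomPrimaryTorsion p) d₁ y)
    {Ψ : AddMonoid.End (Fin m → subgroupH1 (kerD κ 𝔭) (W.geomPrimaryTorsion p))}
    (hΨ : ∀ (f : Fin m → subgroupH1 (kerD κ 𝔭) (W.geomPrimaryTorsion p)) (i : Fin m), Ψ f i = φ (f i))
    (hLP : IsLocNil p (Ψ - 1))
    (hfin : Set.Finite {y : subgroupH1 (kerD κ 𝔭) (W.geomPrimaryTorsion p) |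
      p • y = 0 ∧ conjH1 (kerD κ 𝔭) (W.geomPrimaryTorsion p) d₁ y = y}) :
    letI := hLP.module (A := AddCircle (1 : ℚ))
    Module.Finite (PowerSeries ℤ_[p]) ((Fin m → subgroupH1 (kerD κ 𝔭) (W.geomPrimaryTorsion p)) →+ AddCircle (1 : ℚ)) := by
  letI := hLP.module (A := AddCircle (1 : ℚ))
  refine (isDualPair_id_of_isLocNil p hLP).module_finite ?_
  refine (Set.Finite.pi fun _ : Fin m ↦ hfin).subset fun f hf ↦ ?_
  rw [SetLike.mem_coe, IwasawaDual.mem_piece, pow_one, pow_one] at hf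
  rw [Set.mem_univ_pi]
  intro i
  refine ⟨?_, ?_⟩
  · have := congrFun hf.1 i
    simpa using this
  · have h2 := congrFun hf.2 i
    rw [Pi.zero_apply] at h2
    change Ψ f i - f i = 0 at h2
    rwa [sub_eq_zero, hΨ, hφ] at h2

omit [W.IsElliptic] in
/-- **`#(X_P ⧸ (p^k, ω_n) X_P) = #{y ∈ 𝓗 | p^k y = 0, conj_{d₁^{p^n}} y = y}^m`.** [cite: GreenbergLNM1716, §1 p. 60] -/
theorem natCard_dual_tuple_quotient_eq {𝔭 : HeightOneSpectrum (𝓞 K)} (d₁ : decomp (K := K) 𝔭) (m : ℕ)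
    {φ : AddMonoid.End (subgroupH1 (kerD κ 𝔭) (W.geomPrimaryTorsion p))}
    (hφ : ∀ y, φ y = conjH1 (kerD κ 𝔭) (W.geomPrimaryTorsion p) d₁ y)
    {Ψ : AddMonoid.End (Fin m → subgroupH1 (kerD κ 𝔭) (W.geomPrimaryTorsion p))}
    (hΨ : ∀ (f : Fin m → subgroupH1 (kerD κ 𝔭) (W.geomPrimaryTorsion p)) (i : Fin m), Ψ f i = φ (f i))
    (hLP : IsLocNil p (Ψ - 1)) (n k : ℕ) :
    letI := hLP.module (A := AddCircle (1 : ℚ))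
    Nat.card (((Fin m → subgroupH1 (kerD κ 𝔭) (W.geomPrimaryTorsion p)) →+ AddCircle (1 : ℚ)) ⧸
      (Ideal.span {(p : PowerSeries ℤ_[p]) ^ k, ((1 : PowerSeries ℤ_[p]) + PowerSeries.X) ^ (p ^ n) - 1} • ⊤ :
        Submodule (PowerSeries ℤ_[p]) ((Fin m → subgroupH1 (kerD κ 𝔭) (W.geomPrimaryTorsion p)) →+ AddCircle (1 : ℚ)))) =
      Nat.card {y : subgroupH1 (kerD κ 𝔭) (W.geomPrimaryTorsion p) //
        p ^ k • y = 0 ∧ conjH1 (kerD κ 𝔭) (W.geomPrimaryTorsion p) (d₁ ^ p ^ n) y = y} ^ m := by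
  letI := hLP.module (A := AddCircle (1 : ℚ))
  have hKP := natCard_quotient_span_pow_omega_smul (isDualPair_id_of_isLocNil p hLP) n k
  rw [Nat.cast_pow] at hKP
  rw [hKP]
  exact natCard_tuple_torsion_fixed_eq_pow p κ d₁ m n k hφ hΨ

/-- **`X_P = Hom(𝓗^m, ℚ/ℤ)` is `Λ`-torsion-free under the local two-sided count** (`𝓗 = H¹(kerD κ 𝔭, E[p^∞])`, `𝔭` finitely
decomposed, `κ d₁ = p^c`): no `p`-torsion by the `p`-divisibility of `𝓗`, then p660065. [cite: GreenbergVatsal2000, §2 Prop. (2.1)]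
[cite: Washington1997, §13.2] -/
theorem noZeroSMulDivisors_dual_tuple {𝔭 : HeightOneSpectrum (𝓞 K)} {c : ℕ} (d₁ : decomp (K := K) 𝔭)
    (hd₁ : (κ (d₁ : absoluteGaloisGroup K)).toAdd = (p : ℤ_[p]) ^ c) (m : ℕ)
    {φ : AddMonoid.End (subgroupH1 (kerD κ 𝔭) (W.geomPrimaryTorsion p))}
    (hφ : ∀ y, φ y = conjH1 (kerD κ 𝔭) (W.geomPrimaryTorsion p) d₁ y)
    {Ψ : AddMonoid.End (Fin m → subgroupH1 (kerD κ 𝔭) (W.geomPrimaryTorsion p))}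
    (hΨ : ∀ (f : Fin m → subgroupH1 (kerD κ 𝔭) (W.geomPrimaryTorsion p)) (i : Fin m), Ψ f i = φ (f i))
    (hLP : IsLocNil p (Ψ - 1)) {ρ b : ℕ}
    (hfin1 : Set.Finite {y : subgroupH1 (kerD κ 𝔭) (W.geomPrimaryTorsion p) |
      p • y = 0 ∧ conjH1 (kerD κ 𝔭) (W.geomPrimaryTorsion p) d₁ y = y})
    (hlow : ∀ n k : ℕ, p ^ (ρ * p ^ n * k) ≤
      p ^ b * Nat.card {y : subgroupH1 (kerD κ 𝔭) (W.geomPrimaryTorsion p) //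
        p ^ k • y = 0 ∧ conjH1 (kerD κ 𝔭) (W.geomPrimaryTorsion p) (d₁ ^ p ^ n) y = y})
    (hup : ∀ n k : ℕ, Nat.card {y : subgroupH1 (kerD κ 𝔭) (W.geomPrimaryTorsion p) //
        p ^ k • y = 0 ∧ conjH1 (kerD κ 𝔭) (W.geomPrimaryTorsion p) (d₁ ^ p ^ n) y = y} ≤ p ^ (ρ * p ^ n * k + b)) :
    letI := hLP.module (A := AddCircle (1 : ℚ))
    NoZeroSMulDivisors (PowerSeries ℤ_[p]) ((Fin m → subgroupH1 (kerD κ 𝔭) (W.geomPrimaryTorsion p)) →+ AddCircle (1 : ℚ)) := by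
  letI := hLP.module (A := AddCircle (1 : ℚ))
  haveI := moduleFinite_dual_tuple W p κ d₁ m hφ hΨ hLP hfin1
  have hne := exists_mem_decomp_apply_ne_one_of_toAdd_eq p κ d₁ hd₁
  refine noZeroSMulDivisors_of_card_quotient_bounds p _ (ρ * m) (b * m) (fun x hx ↦ ?_) (fun n k ↦ ?_) (fun n k ↦ ?_)
  · refine AddMonoidHom.ext fun f ↦ ?_
    obtain ⟨g, hg⟩ : ∃ g : Fin m → subgroupH1 (kerD κ 𝔭) (W.geomPrimaryTorsion p), p • g = f := by
      choose g hg using fun i ↦ exists_nsmul_eq_subgroupH1_kerD_of_apply_ne_one W p κ hne (f i)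
      exact ⟨g, funext fun i ↦ by rw [Pi.smul_apply, hg]⟩
    have h1 : ((p : PowerSeries ℤ_[p]) • x) g = 0 := by rw [hx, AddMonoidHom.zero_apply]
    rw [Nat.cast_smul_eq_nsmul] at h1
    change p • x g = 0 at h1
    rw [← hg, map_nsmul, AddMonoidHom.zero_apply]
    exact h1
  · rw [natCard_dual_tuple_quotient_eq W p κ d₁ m hφ hΨ hLP n k]
    have h1 := Nat.pow_le_pow_left (hlow n k) m
    rw [mul_pow, ← pow_mul, ← pow_mul] at h1
    have e1 : ρ * m * p ^ n * k = ρ * p ^ n * k * m := by ring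
    rw [e1]
    exact h1
  · rw [natCard_dual_tuple_quotient_eq W p κ d₁ m hφ hΨ hLP n k]
    have h1 := Nat.pow_le_pow_left (hup n k) m
    rw [← pow_mul] at h1
    have e2 : ρ * m * p ^ n * k + b * m = (ρ * p ^ n * k + b) * m := by ring
    rw [e2]
    exact h1

end Summit.BirchSwinnertonDyer.BirchSwinnertonDyer.Theorems.UniversalToricDescentStrictPlaceGrowth

end
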